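import Literature.Computability.Cryptography.WordRAMToTM2Interp
import HarnessLib

/-!
# Word-RAM oracle programs on multi-stack machines, I: the extended register file

Family `fine-grained`. First part of the change of machine model with a 3SUM oracle
(`Literature.Computability.FineGrained.sparseKSATInExpTime_of_cnfSATInThreeSumOracleRAMTime`,
`NSETHNonReducibility.lean`): a word-RAM *oracle* program, run with the canonical 3SUM oracle at
word size `O(log n)`, is simulated by a structured stack program (`Com`, `StackPrograms.lean`) and
hence by Mathlib's `Turing.FinTM2`, with cost polynomial *per step*. The interpreter of
`WordRAMToTM2Interp.lean` (register file `K ⊕ AReg`: the named registers `St` and the arithmetic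
bank) is reused instruction by instruction through the embedding `Com.map Sum.inl`
(`Com.Runs.inl`: a routine on the left registers of a sum leaves the right registers alone); the
new routines — the table rebuild of the memory log after every step, the brute-force answer to a
`query` — need registers of their own, which this file provides as the right summand `XReg` of the
register file `RQ = (K ⊕ AReg) ⊕ XReg`, by name (`XS`, `XS.regs`, with the `Function.update`
simp-normal form `{ T with r := v }.regs`), together with the combined state
`stateQ ρ F T = Sum.elim (state ρ F) T.regs`.

## References

* S. A. Cook, R. A. Reckhow, *Time bounded random access machines*, JCSS 7 (1973) 354–375, §2.
* T. Nipkow, G. Klein, *Concrete Semantics with Isabelle/HOL*, Springer 2014, §7.2.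
-/

namespace Literature.Computability.Cryptography.WordRAM.ToTM2

open _root_.Computability Complexity Complexity.Com

/-- The extra registers of the oracle interpreter (right summand of the register file). [folklore] -/
inductive XReg where
  | un | cnt | ad | nl | s1 | s2 | s3 | lc | c1 | c2 | c3 | qa | qb | qc | pp | qq | rf | v1 | v2 | v3 | w1 | w2
  deriving DecidableEq, Fintype, Repr

/-- The whole register file of the oracle interpreter: the interpreter's `K ⊕ AReg` on the left,
the extra registers on the right. [folklore] -/
abbrev RQ : Type := (K ⊕ AReg) ⊕ XReg

/-- A named register of the interpreter inside `RQ`. [folklore] -/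
abbrev rK (r : K) : RQ := Sum.inl (Sum.inl r)

/-- A bank register inside `RQ`. [folklore] -/
abbrev rA (r : AReg) : RQ := Sum.inl (Sum.inr r)

/-- An extra register inside `RQ`. [folklore] -/
abbrev rX (r : XReg) : RQ := Sum.inr r

/-- The extra register file by name. [folklore] -/
structure XS where
  /-- the master unary counter `1^{A+1}` (table size), kept throughout the run -/
  un : List Bool
  /-- the loop counter of the table rebuild (a copy of `un`) -/
  cnt : List Bool
  /-- the address numeral of the table rebuild -/
  ad : List Bool
  /-- the new log being built -/
  nl : List Bool
  /-- scratch -/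
  s1 : List Bool
  /-- scratch -/
  s2 : List Bool
  /-- scratch -/
  s3 : List Bool
  /-- the query length in unary -/
  lc : List Bool
  /-- outer loop counter of the 3SUM search -/
  c1 : List Bool
  /-- middle loop counter of the 3SUM search -/
  c2 : List Bool
  /-- inner loop counter of the 3SUM search -/
  c3 : List Bool
  /-- first address numeral of the 3SUM search -/
  qa : List Bool
  /-- second address numeral of the 3SUM search -/
  qb : List Bool
  /-- third address numeral of the 3SUM search -/
  qc : List Bool
  /-- accumulator of the nonnegative parts -/
  pp : List Bool
  /-- accumulator of the negative parts -/
  qq : List Bool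
  /-- the result flag of the 3SUM search -/
  rf : List Bool
  /-- a value read -/
  v1 : List Bool
  /-- a value read -/
  v2 : List Bool
  /-- a value read -/
  v3 : List Bool
  /-- scratch -/
  w1 : List Bool
  /-- scratch -/
  w2 : List Bool

namespace XS

/-- The empty extra file. [folklore] -/
def zero : XS := ⟨[], [], [], [], [], [], [], [], [], [], [], [], [], [], [], [], [], [], [], [], [], []⟩

/-- A field of the empty extra file. [folklore] -/
@[simp] theorem zero_un : zero.un = [] := rfl
/-- A field of the empty extra file. [folklore] -/
@[simp] theorem zero_cnt : zero.cnt = [] := rfl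
/-- A field of the empty extra file. [folklore] -/
@[simp] theorem zero_ad : zero.ad = [] := rfl
/-- A field of the empty extra file. [folklore] -/
@[simp] theorem zero_nl : zero.nl = [] := rfl
/-- A field of the empty extra file. [folklore] -/
@[simp] theorem zero_s1 : zero.s1 = [] := rfl
/-- A field of the empty extra file. [folklore] -/
@[simp] theorem zero_s2 : zero.s2 = [] := rfl
/-- A field of the empty extra file. [folklore] -/
@[simp] theorem zero_s3 : zero.s3 = [] := rfl
/-- A field of the empty extra file. [folklore] -/
@[simp] theorem zero_lc : zero.lc = [] := rfl
/-- A field of the empty extra file. [folklore] -/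
@[simp] theorem zero_c1 : zero.c1 = [] := rfl
/-- A field of the empty extra file. [folklore] -/
@[simp] theorem zero_c2 : zero.c2 = [] := rfl
/-- A field of the empty extra file. [folklore] -/
@[simp] theorem zero_c3 : zero.c3 = [] := rfl
/-- A field of the empty extra file. [folklore] -/
@[simp] theorem zero_qa : zero.qa = [] := rfl
/-- A field of the empty extra file. [folklore] -/
@[simp] theorem zero_qb : zero.qb = [] := rfl
/-- A field of the empty extra file. [folklore] -/
@[simp] theorem zero_qc : zero.qc = [] := rfl
/-- A field of the empty extra file. [folklore] -/
@[simp] theorem zero_pp : zero.pp = [] := rfl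
/-- A field of the empty extra file. [folklore] -/
@[simp] theorem zero_qq : zero.qq = [] := rfl
/-- A field of the empty extra file. [folklore] -/
@[simp] theorem zero_rf : zero.rf = [] := rfl
/-- A field of the empty extra file. [folklore] -/
@[simp] theorem zero_v1 : zero.v1 = [] := rfl
/-- A field of the empty extra file. [folklore] -/
@[simp] theorem zero_v2 : zero.v2 = [] := rfl
/-- A field of the empty extra file. [folklore] -/
@[simp] theorem zero_v3 : zero.v3 = [] := rfl
/-- A field of the empty extra file. [folklore] -/
@[simp] theorem zero_w1 : zero.w1 = [] := rfl
/-- A field of the empty extra file. [folklore] -/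
@[simp] theorem zero_w2 : zero.w2 = [] := rfl

/-- The extra file as a register function. [folklore] -/
def regs (T : XS) : Regs XReg
  | .un => T.un
  | .cnt => T.cnt
  | .ad => T.ad
  | .nl => T.nl
  | .s1 => T.s1
  | .s2 => T.s2
  | .s3 => T.s3
  | .lc => T.lc
  | .c1 => T.c1
  | .c2 => T.c2
  | .c3 => T.c3
  | .qa => T.qa
  | .qb => T.qb
  | .qc => T.qc
  | .pp => T.pp
  | .qq => T.qq
  | .rf => T.rf
  | .v1 => T.v1
  | .v2 => T.v2
  | .v3 => T.v3
  | .w1 => T.w1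
  | .w2 => T.w2

/-- Reading a register of the extra file. [folklore] -/
@[simp] theorem regs_un (T : XS) : T.regs .un = T.un := rfl
/-- Reading a register of the extra file. [folklore] -/
@[simp] theorem regs_cnt (T : XS) : T.regs .cnt = T.cnt := rfl
/-- Reading a register of the extra file. [folklore] -/
@[simp] theorem regs_ad (T : XS) : T.regs .ad = T.ad := rfl
/-- Reading a register of the extra file. [folklore] -/
@[simp] theorem regs_nl (T : XS) : T.regs .nl = T.nl := rfl
/-- Reading a register of the extra file. [folklore] -/
@[simp] theorem regs_s1 (T : XS) : T.regs .s1 = T.s1 := rfl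
/-- Reading a register of the extra file. [folklore] -/
@[simp] theorem regs_s2 (T : XS) : T.regs .s2 = T.s2 := rfl
/-- Reading a register of the extra file. [folklore] -/
@[simp] theorem regs_s3 (T : XS) : T.regs .s3 = T.s3 := rfl
/-- Reading a register of the extra file. [folklore] -/
@[simp] theorem regs_lc (T : XS) : T.regs .lc = T.lc := rfl
/-- Reading a register of the extra file. [folklore] -/
@[simp] theorem regs_c1 (T : XS) : T.regs .c1 = T.c1 := rfl
/-- Reading a register of the extra file. [folklore] -/
@[simp] theorem regs_c2 (T : XS) : T.regs .c2 = T.c2 := rfl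
/-- Reading a register of the extra file. [folklore] -/
@[simp] theorem regs_c3 (T : XS) : T.regs .c3 = T.c3 := rfl
/-- Reading a register of the extra file. [folklore] -/
@[simp] theorem regs_qa (T : XS) : T.regs .qa = T.qa := rfl
/-- Reading a register of the extra file. [folklore] -/
@[simp] theorem regs_qb (T : XS) : T.regs .qb = T.qb := rfl
/-- Reading a register of the extra file. [folklore] -/
@[simp] theorem regs_qc (T : XS) : T.regs .qc = T.qc := rfl
/-- Reading a register of the extra file. [folklore] -/
@[simp] theorem regs_pp (T : XS) : T.regs .pp = T.pp := rfl
/-- Reading a register of the extra file. [folklore] -/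
@[simp] theorem regs_qq (T : XS) : T.regs .qq = T.qq := rfl
/-- Reading a register of the extra file. [folklore] -/
@[simp] theorem regs_rf (T : XS) : T.regs .rf = T.rf := rfl
/-- Reading a register of the extra file. [folklore] -/
@[simp] theorem regs_v1 (T : XS) : T.regs .v1 = T.v1 := rfl
/-- Reading a register of the extra file. [folklore] -/
@[simp] theorem regs_v2 (T : XS) : T.regs .v2 = T.v2 := rfl
/-- Reading a register of the extra file. [folklore] -/
@[simp] theorem regs_v3 (T : XS) : T.regs .v3 = T.v3 := rfl
/-- Reading a register of the extra file. [folklore] -/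
@[simp] theorem regs_w1 (T : XS) : T.regs .w1 = T.w1 := rfl
/-- Reading a register of the extra file. [folklore] -/
@[simp] theorem regs_w2 (T : XS) : T.regs .w2 = T.w2 := rfl

/-- Writing a register of the extra file. [folklore] -/
@[simp] theorem update_regs_un (T : XS) (v : List Bool) :
    Function.update T.regs .un v = { T with un := v }.regs := by
  funext r; cases r <;> rfl
/-- Writing a register of the extra file. [folklore] -/
@[simp] theorem update_regs_cnt (T : XS) (v : List Bool) :
    Function.update T.regs .cnt v = { T with cnt := v }.regs := by
  funext r; cases r <;> rfl
/-- Writing a register of the extra file. [folklore] -/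
@[simp] theorem update_regs_ad (T : XS) (v : List Bool) :
    Function.update T.regs .ad v = { T with ad := v }.regs := by
  funext r; cases r <;> rfl
/-- Writing a register of the extra file. [folklore] -/
@[simp] theorem update_regs_nl (T : XS) (v : List Bool) :
    Function.update T.regs .nl v = { T with nl := v }.regs := by
  funext r; cases r <;> rfl
/-- Writing a register of the extra file. [folklore] -/
@[simp] theorem update_regs_s1 (T : XS) (v : List Bool) :
    Function.update T.regs .s1 v = { T with s1 := v }.regs := by
  funext r; cases r <;> rfl
/-- Writing a register of the extra file. [folklore] -/
@[simp] theorem update_regs_s2 (T : XS) (v : List Bool) :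
    Function.update T.regs .s2 v = { T with s2 := v }.regs := by
  funext r; cases r <;> rfl
/-- Writing a register of the extra file. [folklore] -/
@[simp] theorem update_regs_s3 (T : XS) (v : List Bool) :
    Function.update T.regs .s3 v = { T with s3 := v }.regs := by
  funext r; cases r <;> rfl
/-- Writing a register of the extra file. [folklore] -/
@[simp] theorem update_regs_lc (T : XS) (v : List Bool) :
    Function.update T.regs .lc v = { T with lc := v }.regs := by
  funext r; cases r <;> rfl
/-- Writing a register of the extra file. [folklore] -/
@[simp] theorem update_regs_c1 (T : XS) (v : List Bool) :
    Function.update T.regs .c1 v = { T with c1 := v }.regs := by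
  funext r; cases r <;> rfl
/-- Writing a register of the extra file. [folklore] -/
@[simp] theorem update_regs_c2 (T : XS) (v : List Bool) :
    Function.update T.regs .c2 v = { T with c2 := v }.regs := by
  funext r; cases r <;> rfl
/-- Writing a register of the extra file. [folklore] -/
@[simp] theorem update_regs_c3 (T : XS) (v : List Bool) :
    Function.update T.regs .c3 v = { T with c3 := v }.regs := by
  funext r; cases r <;> rfl
/-- Writing a register of the extra file. [folklore] -/
@[simp] theorem update_regs_qa (T : XS) (v : List Bool) :
    Function.update T.regs .qa v = { T with qa := v }.regs := by
  funext r; cases r <;> rfl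
/-- Writing a register of the extra file. [folklore] -/
@[simp] theorem update_regs_qb (T : XS) (v : List Bool) :
    Function.update T.regs .qb v = { T with qb := v }.regs := by
  funext r; cases r <;> rfl
/-- Writing a register of the extra file. [folklore] -/
@[simp] theorem update_regs_qc (T : XS) (v : List Bool) :
    Function.update T.regs .qc v = { T with qc := v }.regs := by
  funext r; cases r <;> rfl
/-- Writing a register of the extra file. [folklore] -/
@[simp] theorem update_regs_pp (T : XS) (v : List Bool) :
    Function.update T.regs .pp v = { T with pp := v }.regs := by
  funext r; cases r <;> rfl
/-- Writing a register of the extra file. [folklore] -/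
@[simp] theorem update_regs_qq (T : XS) (v : List Bool) :
    Function.update T.regs .qq v = { T with qq := v }.regs := by
  funext r; cases r <;> rfl
/-- Writing a register of the extra file. [folklore] -/
@[simp] theorem update_regs_rf (T : XS) (v : List Bool) :
    Function.update T.regs .rf v = { T with rf := v }.regs := by
  funext r; cases r <;> rfl
/-- Writing a register of the extra file. [folklore] -/
@[simp] theorem update_regs_v1 (T : XS) (v : List Bool) :
    Function.update T.regs .v1 v = { T with v1 := v }.regs := by
  funext r; cases r <;> rfl
/-- Writing a register of the extra file. [folklore] -/
@[simp] theorem update_regs_v2 (T : XS) (v : List Bool) :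
    Function.update T.regs .v2 v = { T with v2 := v }.regs := by
  funext r; cases r <;> rfl
/-- Writing a register of the extra file. [folklore] -/
@[simp] theorem update_regs_v3 (T : XS) (v : List Bool) :
    Function.update T.regs .v3 v = { T with v3 := v }.regs := by
  funext r; cases r <;> rfl
/-- Writing a register of the extra file. [folklore] -/
@[simp] theorem update_regs_w1 (T : XS) (v : List Bool) :
    Function.update T.regs .w1 v = { T with w1 := v }.regs := by
  funext r; cases r <;> rfl
/-- Writing a register of the extra file. [folklore] -/
@[simp] theorem update_regs_w2 (T : XS) (v : List Bool) :
    Function.update T.regs .w2 v = { T with w2 := v }.regs := by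
  funext r; cases r <;> rfl

/-- Every extra register function is the `regs` of a file. [folklore] -/
theorem eq_regs (T : Regs XReg) : T = XS.regs ⟨T .un, T .cnt, T .ad, T .nl, T .s1, T .s2, T .s3, T .lc, T .c1, T .c2, T .c3, T .qa, T .qb, T .qc, T .pp, T .qq, T .rf, T .v1, T .v2, T .v3, T .w1, T .w2⟩ := by
  funext r; cases r <;> rfl

end XS

/-- The combined state of the oracle interpreter: interpreter file, bank, extra file. [folklore] -/
abbrev stateQ (ρ : St) (F : Regs AReg) (T : XS) : Regs RQ := Sum.elim (state ρ F) T.regs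

/-- Updating a named interpreter register of a combined state. [folklore] -/
@[simp] theorem update_stateQ_rK (ρ : St) (F : Regs AReg) (T : XS) (r : K) (v : List Bool) :
    Function.update (stateQ ρ F T) (rK r) v = Sum.elim (Function.update (state ρ F) (Sum.inl r) v) T.regs :=
  Sum.update_elim_inl

/-- Updating a bank register of a combined state. [folklore] -/
@[simp] theorem update_stateQ_rA (ρ : St) (F : Regs AReg) (T : XS) (r : AReg) (v : List Bool) :
    Function.update (stateQ ρ F T) (rA r) v = Sum.elim (Function.update (state ρ F) (Sum.inr r) v) T.regs :=
  Sum.update_elim_inl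

/-- Updating an extra register of a combined state. [folklore] -/
@[simp] theorem update_stateQ_rX (ρ : St) (F : Regs AReg) (T : XS) (r : XReg) (v : List Bool) :
    Function.update (stateQ ρ F T) (rX r) v = Sum.elim (state ρ F) (Function.update T.regs r v) :=
  Sum.update_elim_inr

/-- Reading a named interpreter register of a combined state. [folklore] -/
@[simp] theorem stateQ_rK (ρ : St) (F : Regs AReg) (T : XS) (r : K) : stateQ ρ F T (rK r) = ρ.regs r := rfl

/-- Reading a bank register of a combined state. [folklore] -/
@[simp] theorem stateQ_rA (ρ : St) (F : Regs AReg) (T : XS) (r : AReg) : stateQ ρ F T (rA r) = F r := rfl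

/-- Reading an extra register of a combined state. [folklore] -/
@[simp] theorem stateQ_rX (ρ : St) (F : Regs AReg) (T : XS) (r : XReg) : stateQ ρ F T (rX r) = T.regs r := rfl

/-- **Interpreter routines run on the combined file**, leaving the extra registers alone
(`Com.Runs.inl`). [folklore] -/
theorem runs_inl_stateQ {c : Com (K ⊕ AReg)} {ρ ρ' : St} {F F' : Regs AReg} {B : ℕ}
    (h : Runs c (state ρ F) (state ρ' F') B) (T : XS) :
    Runs (c.map Sum.inl) (stateQ ρ F T) (stateQ ρ' F' T) B :=
  h.inl T.regs

end Literature.Computability.Cryptography.WordRAM.ToTM2
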